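import Summits.BirchSwinnertonDyer.BirchSwinnertonDyer.Theses.KatoDescentPotSupersingular
import Summits.BirchSwinnertonDyer.BirchSwinnertonDyer.Theorems.KatoDescentPotSupersingularReducibleUpperOfCoreInputs
import Literature.NumberTheory.EllipticCurves.Kato2004.IwasawaCohomologyExistsProofs
import HarnessLib

/-!
# Glue item `WildUpperReducibleDefectOfCorePackage` of route `KatoDescentPotSupersingular` (K9, gen-3 resplit of U₀-red 19190), BY NAME
# (item stmt-BirchSwinnertonDyer-22947; crux M / U₀-red consolidation, TARGET R283/R285; `--workitem`)

Seat `bsd-potss-rkm` g25 (prover; cell `bsd-potss`; wake W-M7 E3).  The glue decl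
`WildUpperReducibleDefectOfCorePackage := PublishedInputModularityRed → PublishedInputsCasselsGZKEntireRed → PublishedInputKatoCorePackageRed →
WildUpperReducibleDefect` (K9 rev 48) is the composition of the modularity child, the 3-bundle child 27716 (Cassels ∧ GZK ∧ entire `L`) and the
Kato CORE member package child 22946 (the constant of crux M's child 27962) through seat rkm g24's route-free theorem
`ReducibleUpperOfCoreInputs.missingUpperBoundAt_of_coreInputs'` (p648052; Poitou–Tate over `ℚ` by theorem; Iwasawa `H¹` data by the tree
theorem `Kato2004.nonempty_iwasawaH1Data_holds`) — the body of p648390's `wildUpperReducibleDefect_of_coreInputs` inlined so that this file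
imports the route file and route-FREE modules only (theses-cone lint); the same term as the planner's certified closer / refuter1-g13's
by-name check (shape `fun hN hB hC => … hN hC hB.1 hB.2.1 hB.2.2`).  HONEST FRAMING: closes a GLUE item only; the held input (Kato's Euler system + explicit reciprocity
at the member) is unchanged; BSD is proved for no curve.

References: K. Kato, Astérisque 295 (2004), §14.14 (p. 243), proof of Prop. 14.16 (pp. 244–245) [Kato2004Asterisque]; J. W. S. Cassels,
J. reine angew. Math. 217 (1965) [Cassels1965ArithmeticVIII].
-/

-- the summit and its single problem are both named `BirchSwinnertonDyer` (registry layout D-0017)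
set_option linter.dupNamespace false
set_option autoImplicit false

noncomputable section

open WeierstrassCurve Literature.NumberTheory.EllipticCurves Literature.NumberTheory.EllipticCurves.ModularForms
  Literature.NumberTheory.EllipticCurves.Kato2004 Literature.NumberTheory.GaloisCohomology
  Literature.NumberTheory.EllipticCurves.Rank1Residual Literature.NumberTheory.EllipticCurves.Rank1Residual.Typed
open Summit.BirchSwinnertonDyer.Rank1Residual Summit.BirchSwinnertonDyer.Rank1Residual.Additive
open Summit.BirchSwinnertonDyer.BirchSwinnertonDyer.Theorems

namespace Summit.BirchSwinnertonDyer.BirchSwinnertonDyer.Theorems.ReducibleUpperOfCoreInputs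

/-- **Glue 22947 by name: `WildUpperReducibleDefectOfCorePackage`** — `fun hN hB hC => wildUpperReducibleDefect_of_coreInputs
nonempty_iwasawaH1Data_holds hN hC hB.1 hB.2.1 hB.2.2`, with p648390's body inlined over the route-free p648052.
[cite: Kato2004Asterisque, §14.14 (p. 243) and proof of Prop. 14.16 (pp. 244–245)] [cite: Cassels1965ArithmeticVIII] -/
theorem wildUpperReducibleDefectOfCorePackage_proof :
    Summit.BirchSwinnertonDyer.BirchSwinnertonDyer.Theses.KatoDescentPotSupersingular.WildUpperReducibleDefectOfCorePackage :=
  fun hN hB hC W _ _ _ hr hO hred _ =>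
    missingUpperBoundAt_of_coreInputs' Kato2004.nonempty_iwasawaH1Data_holds hN hC hB.1 hB.2.1 hB.2.2
      W 3 hO.1 hO.2.1.1 hO.2.1.2 hO.padicValRat_j_nonneg hred hr

end Summit.BirchSwinnertonDyer.BirchSwinnertonDyer.Theorems.ReducibleUpperOfCoreInputs

end
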